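import Mathlib.NumberTheory.Zsqrtd.GaussianInt
import Mathlib.NumberTheory.Zsqrtd.QuadraticReciprocity
import Mathlib.NumberTheory.SumTwoSquares
import Mathlib.Data.Int.Interval
import Mathlib.RingTheory.Coprime.Lemmas
import Mathlib.RingTheory.PrincipalIdealDomain
import HarnessLib

/-!
# Primary Gaussian integers and the multiplicative sums `S(m) = ∑_{x primary, N(x) = m} x`

Topic `Literature/NumberTheory/QuadraticFields`. Filed for the named fact
`Literature.NumberTheory.EllipticCurves.hasEntireLFunction_congruentNumberCurve` of
`Literature.NumberTheory.EllipticCurves.BSDAnalyticRankProofs` (continuation of `L(E_n, s)` for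
the congruent number curves `E_n : y² = x³ - n² x`): the arithmetic half of the identification
`L(E_n, s) = L(s, χ_n)` with a Hecke `L`-series of `ℚ(i)` (Ireland–Rosen, Ch. 18 §6, Theorem 7;
Koblitz, Ch. II §5), whose analytic half is
`Literature.NumberTheory.LFunctions.GaussianThetaSeries`. Everything here is proved (Mathlib only).

## Content (namespace `Literature.GaussianPrimary`)

* `IsPrimary x` — `x ≡ 1 (mod (2 + 2i))`, taken in Ireland–Rosen's congruence form
  `re x ≡ 1, im x ≡ 0 (4)` or `re x ≡ 3, im x ≡ 2 (4)` (Ch. 9 §7, Definition and Lemma 6;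
  `isPrimary_iff_dvd`); closed under products and `star`; two associated primary elements are
  equal (`IsPrimary.eq_of_associated`, Lemma 7).
* `primary x` — the unique primary associate of `x` when `1 + i ∤ x` (Lemma 7:
  `isPrimary_primary`, `exists_isUnit_primary_eq`, `primary_eq_of_associated`), and `0` when
  `1 + i ∣ x` (`primary_eq_zero_of_even`). It is **multiplicative** on all of `ℤ[i]`
  (`primary_mul`, `primary_pow`, `primary_star`, `primary_isUnit_mul`).
* `primaryNormEq m`, `primarySum m = S(m) = ∑_{x primary, N(x) = m} x`, and:
  `S(1) = 1` (`primarySum_one`), `S(m) = 0` for even `m` (`primarySum_of_even`),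
  **`S(m m') = S(m) S(m')` for coprime `m, m'`** (`primarySum_mul_of_coprime`: the bijection
  `(y, z) ↦ y z`, via Bézout in the Euclidean domain `ℤ[i]`),
  **`S(p^{2j}) = (-p)^j`, `S(p^{2j+1}) = 0` for `p ≡ 3 (4)`** (`primarySum_pow_of_mod_four_eq_three`;
  elements of norm `p^k` are `u p^{k/2}`), and
  **`S(p^k) = ∑_{j=0}^{k} π^j π̄^{k-j}` for `p ≡ 1 (4)`, `p = N(π)`, `π` primary**
  (`primarySum_pow_of_mod_four_eq_one`; elements of norm `p^k` are `u π^j π̄^{k-j}`, `π ∤ π̄`),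
  with the existence of such `π` (`exists_isPrimary_norm_eq`, two squares) and the recursion
  `T_{k+2} = (π + σ) T_{k+1} - π σ T_k` of these sums (`sum_pow_mul_pow_rec`).

These are exactly the Euler-factor computations of Ireland–Rosen's proof of Theorem 18.7
(`L(E, s) = ∏_P (1 - χ(P) NP^{-s})^{-1} = ∑_A χ(A) NA^{-s}` with `χ((π)) = \overline{(D/π)₄} π`,
`π` primary, `χ((p)) = -p` at inert `p`): for `D = n²` the quartic symbol is `±1` and
`∑_{N A = m} χ_{n²}(A) = (n/m) S(m)` (Jacobi symbol), which is how the sums `S(m)` enter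
`L(E_n, s)`.

## References

* K. Ireland, M. Rosen, *A Classical Introduction to Modern Number Theory*, 2nd ed., GTM 84
  (1990): Ch. 9 §7, Definition and Lemmas 6–8 (primary elements of `ℤ[i]`, PDF p. 128); Ch. 18
  §6, Theorem 7 and its proof (PDF pp. 303–304) — held, read via
  `lit read book:ireland1982-classical-introduction-modern-number-theory`.
* N. Koblitz, *Introduction to Elliptic Curves and Modular Forms*, GTM 97, 2nd ed. (1993),
  Ch. II §5 (the map `x ↦ x̃`, primary representatives `≡ 1 (2 + 2i)`, and `L(E_n, s) = L(χ̃_n, s)`)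
  — not held.
-/

namespace Literature.NumberTheory.QuadraticFields

namespace GaussianPrimary

local notation "ℤ[i]" => GaussianInt

open Zsqrtd

/-! ### Units and parity -/

/-- The units of `ℤ[i]` are `±1, ±i`. [folklore] -/
theorem eq_of_isUnit {u : ℤ[i]} (hu : IsUnit u) :
    u = 1 ∨ u = -1 ∨ u = ⟨0, 1⟩ ∨ u = ⟨0, -1⟩ := by
  have h := (Zsqrtd.norm_eq_one_iff' (by norm_num) u).mpr hu
  rw [Zsqrtd.norm_def] at h
  have h' : u.re * u.re + u.im * u.im = 1 := by linarith
  have h1 : u.re * u.re ≤ 1 := by nlinarith [mul_self_nonneg u.im]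
  have h2 : u.im * u.im ≤ 1 := by nlinarith [mul_self_nonneg u.re]
  have hre : -1 ≤ u.re ∧ u.re ≤ 1 := by constructor <;> nlinarith
  have him : -1 ≤ u.im ∧ u.im ≤ 1 := by constructor <;> nlinarith
  obtain ⟨a, b⟩ := u
  simp only at h hre him ⊢
  rcases hre with ⟨ha1, ha2⟩
  rcases him with ⟨hb1, hb2⟩
  interval_cases a <;> interval_cases b <;> simp_all (config := {decide := true})

/-- `N(x) ≡ re x + im x (mod 2)`. [folklore] -/
theorem norm_emod_two (x : ℤ[i]) : x.norm % 2 = (x.re + x.im) % 2 := by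
  rw [Zsqrtd.norm_def, Int.add_emod, Int.sub_emod, Int.mul_emod x.re, Int.mul_emod (-1 * x.im)]
  have h1 := Int.emod_two_eq_zero_or_one x.re
  have h2 := Int.emod_two_eq_zero_or_one x.im
  rcases h1 with h1 | h1 <;> rcases h2 with h2 | h2 <;> simp [h1, h2, Int.neg_emod_two]

/-! ### Primary elements -/

/-- A Gaussian integer `x = a + b i` is *primary* if `x ≡ 1 (mod (2 + 2i))`, equivalently
(`isPrimary_iff_dvd`) `a ≡ 1, b ≡ 0 (mod 4)` or `a ≡ 3, b ≡ 2 (mod 4)` (Ireland–Rosen, Ch. 9 §7,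
Lemma 6 and the Definition before it). We take the congruence description as the definition
(it is decidable). [folklore] -/
def IsPrimary (x : ℤ[i]) : Prop :=
  x.re % 4 = 1 ∧ x.im % 4 = 0 ∨ x.re % 4 = 3 ∧ x.im % 4 = 2

/-- Primarity is decidable. [folklore] -/
instance : DecidablePred IsPrimary := fun _ ↦ inferInstanceAs (Decidable (_ ∨ _))

/-- `x` is primary iff `2 + 2i ∣ x - 1` (Ireland–Rosen, Ch. 9 §7, Lemma 6). [folklore] -/
theorem isPrimary_iff_dvd (x : ℤ[i]) : IsPrimary x ↔ (⟨2, 2⟩ : ℤ[i]) ∣ x - 1 := by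
  constructor
  · intro h
    refine ⟨⟨(x.re - 1 + x.im) / 4, (x.im - (x.re - 1)) / 4⟩, Zsqrtd.ext ?_ ?_⟩
    · simp only [Zsqrtd.re_sub, Zsqrtd.re_one, Zsqrtd.re_mul]
      rcases h with ⟨h1, h2⟩ | ⟨h1, h2⟩ <;> omega
    · simp only [Zsqrtd.im_sub, Zsqrtd.im_one, Zsqrtd.im_mul]
      rcases h with ⟨h1, h2⟩ | ⟨h1, h2⟩ <;> omega
  · rintro ⟨y, hy⟩
    have h1 := congrArg Zsqrtd.re hy
    have h2 := congrArg Zsqrtd.im hy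
    simp only [Zsqrtd.re_sub, Zsqrtd.re_one, Zsqrtd.re_mul, Zsqrtd.im_sub, Zsqrtd.im_one,
      Zsqrtd.im_mul] at h1 h2
    unfold IsPrimary
    omega

/-- `1` is primary. [folklore] -/
theorem isPrimary_one : IsPrimary 1 := by decide

/-- A primary element has `re + im` odd (it is prime to `1 + i`). [folklore] -/
theorem IsPrimary.odd {x : ℤ[i]} (hx : IsPrimary x) : (x.re + x.im) % 2 = 1 := by
  unfold IsPrimary at hx; omega

/-- A primary element has odd norm. [folklore] -/
theorem IsPrimary.norm_odd {x : ℤ[i]} (hx : IsPrimary x) : x.norm % 2 = 1 := by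
  rw [norm_emod_two]; exact hx.odd

/-- A primary element is nonzero. [folklore] -/
theorem IsPrimary.ne_zero {x : ℤ[i]} (hx : IsPrimary x) : x ≠ 0 := by
  rintro rfl; unfold IsPrimary at hx; simp at hx

/-- Products of primary elements are primary. [folklore] -/
theorem IsPrimary.mul {x y : ℤ[i]} (hx : IsPrimary x) (hy : IsPrimary y) : IsPrimary (x * y) := by
  rw [isPrimary_iff_dvd] at hx hy ⊢
  have : x * y - 1 = (x - 1) * y + (y - 1) := by ring
  rw [this]
  exact dvd_add (hx.mul_right _) hy

/-- Powers of a primary element are primary. [folklore] -/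
theorem IsPrimary.pow {x : ℤ[i]} (hx : IsPrimary x) (k : ℕ) : IsPrimary (x ^ k) := by
  induction k with
  | zero => simpa using isPrimary_one
  | succ k ih => rw [pow_succ]; exact ih.mul hx

/-- `star` preserves primarity. [folklore] -/
theorem IsPrimary.star {x : ℤ[i]} (hx : IsPrimary x) : IsPrimary (star x) := by
  unfold IsPrimary at hx ⊢
  simp only [Zsqrtd.re_star, Zsqrtd.im_star]
  omega

/-- **Uniqueness of the primary associate**: if `x` and `u x` are both primary for a unit `u`,
then `u = 1` (Ireland–Rosen, Ch. 9 §7, Lemma 7). [folklore] -/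
theorem IsPrimary.eq_one_of_isUnit {x u : ℤ[i]} (hx : IsPrimary x) (hu : IsUnit u)
    (hux : IsPrimary (u * x)) : u = 1 := by
  rcases eq_of_isUnit hu with rfl | rfl | rfl | rfl
  · rfl
  all_goals
    exfalso
    unfold IsPrimary at hx hux
    simp only [Zsqrtd.re_mul, Zsqrtd.im_mul, Zsqrtd.re_neg, Zsqrtd.im_neg, Zsqrtd.re_one,
      Zsqrtd.im_one] at hux
    omega

/-- Two associated primary elements are equal. [folklore] -/
theorem IsPrimary.eq_of_associated {y y' : ℤ[i]} (hy : IsPrimary y) (hy' : IsPrimary y')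
    (h : Associated y y') : y = y' := by
  obtain ⟨u, rfl⟩ := h
  have hu : (u : ℤ[i]) = 1 := hy.eq_one_of_isUnit u.isUnit (by rwa [mul_comm])
  rw [hu, mul_one]

/-- The *primary associate* of `x`: the unique `u x`, `u` a unit, which is primary, if
`re x + im x` is odd; and `0` if `x` is divisible by `1 + i` (Ireland–Rosen, Ch. 9 §7,
Lemma 7: every element prime to `1 + i` has exactly one primary associate). [folklore] -/
def primary (x : ℤ[i]) : ℤ[i] :=
  if IsPrimary x then x else if IsPrimary (-x) then -x
  else if IsPrimary (⟨0, 1⟩ * x) then ⟨0, 1⟩ * x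
  else if IsPrimary (-(⟨0, 1⟩ * x)) then -(⟨0, 1⟩ * x) else 0

/-- A primary element is its own primary associate. [folklore] -/
theorem primary_of_isPrimary {x : ℤ[i]} (h : IsPrimary x) : primary x = x := if_pos h

/-- `i` is a unit of `ℤ[i]`. [folklore] -/
theorem isUnit_I : IsUnit (⟨0, 1⟩ : ℤ[i]) :=
  isUnit_iff_exists_inv.mpr ⟨⟨0, -1⟩, by ext <;> simp [Zsqrtd.re_mul, Zsqrtd.im_mul]⟩

/-- `re (i x) = -im x`. [folklore] -/
@[simp] theorem re_I_mul (x : ℤ[i]) : ((⟨0, 1⟩ : ℤ[i]) * x).re = -x.im := by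
  simp [Zsqrtd.re_mul]

/-- `im (i x) = re x`. [folklore] -/
@[simp] theorem im_I_mul (x : ℤ[i]) : ((⟨0, 1⟩ : ℤ[i]) * x).im = x.re := by
  simp [Zsqrtd.im_mul]

/-- Primarity of `-x` in terms of `x`. [folklore] -/
theorem isPrimary_neg_iff (x : ℤ[i]) :
    IsPrimary (-x) ↔ x.re % 4 = 3 ∧ x.im % 4 = 0 ∨ x.re % 4 = 1 ∧ x.im % 4 = 2 := by
  unfold IsPrimary; simp only [Zsqrtd.re_neg, Zsqrtd.im_neg]; omega

/-- Primarity of `i x` in terms of `x`. [folklore] -/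
theorem isPrimary_I_mul_iff (x : ℤ[i]) :
    IsPrimary (⟨0, 1⟩ * x) ↔ x.im % 4 = 3 ∧ x.re % 4 = 0 ∨ x.im % 4 = 1 ∧ x.re % 4 = 2 := by
  unfold IsPrimary; rw [re_I_mul, im_I_mul]; omega

/-- Primarity of `-i x` in terms of `x`. [folklore] -/
theorem isPrimary_neg_I_mul_iff (x : ℤ[i]) :
    IsPrimary (-(⟨0, 1⟩ * x)) ↔ x.im % 4 = 1 ∧ x.re % 4 = 0 ∨ x.im % 4 = 3 ∧ x.re % 4 = 2 := by
  unfold IsPrimary; simp only [Zsqrtd.re_neg, Zsqrtd.im_neg, re_I_mul, im_I_mul]; omega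

/-- For `x` prime to `1 + i`, `primary x` is primary. [folklore] -/
theorem isPrimary_primary {x : ℤ[i]} (h : (x.re + x.im) % 2 = 1) : IsPrimary (primary x) := by
  unfold primary
  split_ifs with h1 h2 h3 h4
  · exact h1
  · exact h2
  · exact h3
  · exact h4
  · exfalso
    rw [isPrimary_neg_iff] at h2
    rw [isPrimary_I_mul_iff] at h3
    rw [isPrimary_neg_I_mul_iff] at h4
    unfold IsPrimary at h1
    omega

/-- For `x` divisible by `1 + i` (i.e. `re x + im x` even) there is no primary associate:
`primary x = 0`. [folklore] -/
theorem primary_eq_zero_of_even {x : ℤ[i]} (h : (x.re + x.im) % 2 = 0) : primary x = 0 := by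
  unfold primary
  split_ifs with h1 h2 h3 h4
  · exfalso; unfold IsPrimary at h1; omega
  · exfalso; rw [isPrimary_neg_iff] at h2; omega
  · exfalso; rw [isPrimary_I_mul_iff] at h3; omega
  · exfalso; rw [isPrimary_neg_I_mul_iff] at h4; omega
  · rfl

/-- `primary x = u x` for a unit `u`, when `x` is prime to `1 + i`. [folklore] -/
theorem exists_isUnit_primary_eq {x : ℤ[i]} (h : (x.re + x.im) % 2 = 1) :
    ∃ u : ℤ[i], IsUnit u ∧ primary x = u * x := by
  unfold primary
  split_ifs with h1 h2 h3 h4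
  · exact ⟨1, isUnit_one, (one_mul x).symm⟩
  · exact ⟨-1, isUnit_one.neg, by ring⟩
  · exact ⟨⟨0, 1⟩, isUnit_I, rfl⟩
  · exact ⟨-⟨0, 1⟩, isUnit_I.neg, by ring⟩
  · exfalso
    rw [isPrimary_neg_iff] at h2
    rw [isPrimary_I_mul_iff] at h3
    rw [isPrimary_neg_I_mul_iff] at h4
    unfold IsPrimary at h1
    omega

/-- `primary x` is associated to `x` (for `x` prime to `1 + i`). [folklore] -/
theorem associated_primary {x : ℤ[i]} (h : (x.re + x.im) % 2 = 1) : Associated x (primary x) := by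
  obtain ⟨u, hu, hux⟩ := exists_isUnit_primary_eq h
  exact ⟨hu.unit, by rw [hux, mul_comm]; rfl⟩

/-- Parity of `re + im` is that of the norm, hence multiplicative. [folklore] -/
theorem parity_mul (x y : ℤ[i]) :
    ((x * y).re + (x * y).im) % 2 = (x.re + x.im) % 2 * ((y.re + y.im) % 2) % 2 := by
  rw [← norm_emod_two, ← norm_emod_two, ← norm_emod_two, Zsqrtd.norm_mul, Int.mul_emod]

/-- Associated elements have the same parity. [folklore] -/
theorem parity_eq_of_associated {x y : ℤ[i]} (h : Associated x y) :
    (x.re + x.im) % 2 = (y.re + y.im) % 2 := by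
  obtain ⟨u, rfl⟩ := h
  rw [← norm_emod_two, ← norm_emod_two, Zsqrtd.norm_mul,
    (Zsqrtd.norm_eq_one_iff' (by norm_num) _).mpr u.isUnit, mul_one]

/-- **The primary associate is characterised by primarity and association.** [folklore] -/
theorem primary_eq_of_associated {x y : ℤ[i]} (h : Associated x y) (hy : IsPrimary y) :
    primary x = y := by
  have hx : (x.re + x.im) % 2 = 1 := by rw [parity_eq_of_associated h]; exact hy.odd
  exact (isPrimary_primary hx).eq_of_associated hy ((associated_primary hx).symm.trans h)

/-- `primary` is constant on associate classes. [folklore] -/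
theorem primary_eq_primary_of_associated {x y : ℤ[i]} (h : Associated x y) : primary x = primary y := by
  by_cases hy : (y.re + y.im) % 2 = 1
  · exact primary_eq_of_associated (h.trans (associated_primary hy)) (isPrimary_primary hy)
  · rw [primary_eq_zero_of_even (x := y) (by omega), primary_eq_zero_of_even]
    rw [parity_eq_of_associated h]; omega

/-- **`primary` is multiplicative**: `primary (x y) = primary x · primary y`. [folklore] -/
theorem primary_mul (x y : ℤ[i]) : primary (x * y) = primary x * primary y := by
  by_cases hx : (x.re + x.im) % 2 = 1
  · by_cases hy : (y.re + y.im) % 2 = 1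
    · refine primary_eq_of_associated ?_ ((isPrimary_primary hx).mul (isPrimary_primary hy))
      exact (associated_primary hx).mul_mul (associated_primary hy)
    · rw [primary_eq_zero_of_even (x := y) (by omega), mul_zero, primary_eq_zero_of_even]
      rw [parity_mul]
      have : (y.re + y.im) % 2 = 0 := by omega
      rw [this]; simp
  · rw [primary_eq_zero_of_even (x := x) (by omega), zero_mul, primary_eq_zero_of_even]
    rw [parity_mul]
    have : (x.re + x.im) % 2 = 0 := by omega
    rw [this]; simp

/-- The primary associate of a unit is `1`. [folklore] -/
theorem primary_of_isUnit {u : ℤ[i]} (hu : IsUnit u) : primary u = 1 :=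
  primary_eq_of_associated (associated_one_iff_isUnit.mpr hu) isPrimary_one

/-- `primary 1 = 1`. [folklore] -/
@[simp] theorem primary_one : primary 1 = 1 := primary_of_isUnit isUnit_one

/-- `primary (u x) = primary x` for a unit `u`. [folklore] -/
theorem primary_isUnit_mul {u : ℤ[i]} (hu : IsUnit u) (x : ℤ[i]) : primary (u * x) = primary x := by
  rw [primary_mul, primary_of_isUnit hu, one_mul]

/-- `primary (-x) = primary x`. [folklore] -/
@[simp] theorem primary_neg (x : ℤ[i]) : primary (-x) = primary x := by
  rw [neg_eq_neg_one_mul, primary_isUnit_mul isUnit_one.neg]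

/-- `primary (x^k) = (primary x)^k`. [folklore] -/
theorem primary_pow (x : ℤ[i]) (k : ℕ) : primary (x ^ k) = primary x ^ k := by
  induction k with
  | zero => simp
  | succ k ih => rw [pow_succ, primary_mul, ih, pow_succ]

/-- `primary (star x) = star (primary x)`. [folklore] -/
theorem primary_star (x : ℤ[i]) : primary (star x) = star (primary x) := by
  by_cases hx : (x.re + x.im) % 2 = 1
  · refine primary_eq_of_associated ?_ (isPrimary_primary hx).star
    obtain ⟨u, hu, hux⟩ := exists_isUnit_primary_eq hx
    exact ⟨hu.star.unit, by rw [IsUnit.unit_spec, hux, star_mul]⟩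
  · have hx' : (x.re + x.im) % 2 = 0 := by omega
    rw [primary_eq_zero_of_even hx', star_zero, primary_eq_zero_of_even]
    simp only [Zsqrtd.re_star, Zsqrtd.im_star]; omega

/-- The norm of the primary associate. [folklore] -/
theorem norm_primary {x : ℤ[i]} (h : (x.re + x.im) % 2 = 1) : (primary x).norm = x.norm := by
  obtain ⟨u, hu, hux⟩ := exists_isUnit_primary_eq h
  rw [hux, Zsqrtd.norm_mul, (Zsqrtd.norm_eq_one_iff' (by norm_num) u).mpr hu, one_mul]

/-! ### The sums `S(m)` of primary elements of norm `m` -/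

/-- The (finite) set of primary Gaussian integers of norm `m`. [folklore] -/
def primaryNormEq (m : ℕ) : Finset ℤ[i] :=
  (((Finset.Icc (-(m : ℤ)) m) ×ˢ (Finset.Icc (-(m : ℤ)) m)).image
    fun p : ℤ × ℤ ↦ (⟨p.1, p.2⟩ : ℤ[i])).filter fun x ↦ x.norm = m ∧ IsPrimary x

/-- `x ∈ primaryNormEq m ↔ N(x) = m ∧ x primary`. [folklore] -/
theorem mem_primaryNormEq {m : ℕ} {x : ℤ[i]} :
    x ∈ primaryNormEq m ↔ x.norm = m ∧ IsPrimary x := by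
  simp only [primaryNormEq, Finset.mem_filter, Finset.mem_image, Finset.mem_product,
    Finset.mem_Icc, Prod.exists, and_iff_right_iff_imp]
  rintro ⟨h, -⟩
  refine ⟨x.re, x.im, ⟨?_, ?_⟩, rfl⟩
  · have h1 : (x.re.natAbs : ℤ) ≤ m := by
      rw [← h, Zsqrtd.norm_def]
      nlinarith [Int.natAbs_le_self_sq x.re, sq_nonneg x.im]
    constructor <;> omega
  · have h1 : (x.im.natAbs : ℤ) ≤ m := by
      rw [← h, Zsqrtd.norm_def]
      nlinarith [Int.natAbs_le_self_sq x.im, sq_nonneg x.re]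
    constructor <;> omega

/-- **`S(m) = ∑_{x primary, N(x) = m} x`**, the `m`-th coefficient of the Hecke `L`-series
`¼ ∑_{x odd} x̃ N(x)^{-s} = ∑_{x primary} x N(x)^{-s}` of `ℚ(i)` attached to `y² = x³ - x`
(Ireland–Rosen, Ch. 18 §6; Koblitz, Ch. II §5). [folklore] -/
def primarySum (m : ℕ) : ℤ[i] := ∑ x ∈ primaryNormEq m, x

/-- `S(1) = 1`: the only primary unit is `1`. [folklore] -/
theorem primaryNormEq_one : primaryNormEq 1 = {1} := by decide +kernel

/-- `S(1) = 1`. [folklore] -/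
@[simp] theorem primarySum_one : primarySum 1 = 1 := by
  rw [primarySum, primaryNormEq_one, Finset.sum_singleton]

/-- No primary element has even norm. [folklore] -/
theorem primaryNormEq_eq_empty_of_even {m : ℕ} (hm : 2 ∣ m) : primaryNormEq m = ∅ := by
  ext x
  simp only [mem_primaryNormEq, Finset.notMem_empty, iff_false, not_and]
  intro hx hp
  have := hp.norm_odd
  omega

/-- `S(m) = 0` for even `m`. [folklore] -/
theorem primarySum_of_even {m : ℕ} (hm : 2 ∣ m) : primarySum m = 0 := by
  rw [primarySum, primaryNormEq_eq_empty_of_even hm, Finset.sum_empty]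

/-- `x ∣ N(x)` in `ℤ[i]` (`N(x) = x x̄`). [folklore] -/
theorem self_dvd_norm (x : ℤ[i]) : x ∣ (x.norm : ℤ[i]) :=
  ⟨star x, Zsqrtd.norm_eq_mul_conj x⟩

/-- Coprime naturals are coprime in `ℤ[i]`. [folklore] -/
theorem isCoprime_natCast {m m' : ℕ} (h : m.Coprime m') : IsCoprime (m : ℤ[i]) (m' : ℤ[i]) := by
  have := (Nat.isCoprime_iff_coprime.mpr h).map (Int.castRingHom ℤ[i])
  simpa using this

/-- If `a ∣ b` in `ℤ[i]` then `N(a) ∣ N(b)`. [folklore] -/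
theorem norm_dvd_norm {a b : ℤ[i]} (h : a ∣ b) : a.norm ∣ b.norm := by
  obtain ⟨c, rfl⟩ := h
  exact ⟨c.norm, Zsqrtd.norm_mul a c⟩

/-- Two naturals dividing `m`, `m'` with product `m m' ≠ 0` are `m`, `m'`. [folklore] -/
theorem eq_of_dvd_of_mul_eq {a b m m' : ℕ} (ha : a ∣ m) (hb : b ∣ m') (hab : a * b = m * m')
    (hm : m ≠ 0) (hm' : m' ≠ 0) : a = m ∧ b = m' := by
  obtain ⟨c, rfl⟩ := ha
  obtain ⟨e, rfl⟩ := hb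
  have ha0 : a ≠ 0 := fun h ↦ hm (by simp [h])
  have hb0 : b ≠ 0 := fun h ↦ hm' (by simp [h])
  have h1 : a * b * 1 = a * b * (c * e) := by rw [mul_one]; linear_combination hab
  have h2 : c * e = 1 := (mul_left_cancel₀ (mul_ne_zero ha0 hb0) h1).symm
  rw [mul_eq_one] at h2
  simp [h2.1, h2.2]

/-- **Multiplicativity of `S`**: `S(m m') = S(m) S(m')` for coprime `m, m'` — the map
`(y, z) ↦ y z` is a bijection from pairs of primary elements of norms `m`, `m'` onto the primary
elements of norm `m m'` (unique factorisation in `ℤ[i]`; Ireland–Rosen, Ch. 18 §6, proof of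
Theorem 7, "`L(E,s) = ∏_P (1 - χ(P) NP^{-s})^{-1} = ∑_A χ(A) NA^{-s}`"). [folklore] -/
theorem primarySum_mul_of_coprime {m m' : ℕ} (h : m.Coprime m') :
    primarySum (m * m') = primarySum m * primarySum m' := by
  rw [primarySum, primarySum, primarySum, Finset.sum_mul_sum, ← Finset.sum_product']
  symm
  have hcop : IsCoprime (m : ℤ[i]) (m' : ℤ[i]) := isCoprime_natCast h
  -- a primary element of norm `m` divides `m`
  have hdvd : ∀ {y : ℤ[i]} {k : ℕ}, y.norm = k → y ∣ (k : ℤ[i]) := fun {y k} hy ↦ by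
    have := self_dvd_norm y
    rwa [hy, Int.cast_natCast] at this
  refine Finset.sum_bij (fun p _ ↦ p.1 * p.2) ?_ ?_ ?_ (fun _ _ ↦ rfl)
  · -- maps into
    rintro ⟨y, z⟩ hp
    rw [Finset.mem_product] at hp
    obtain ⟨hy, hyp⟩ := mem_primaryNormEq.mp hp.1
    obtain ⟨hz, hzp⟩ := mem_primaryNormEq.mp hp.2
    refine mem_primaryNormEq.mpr ⟨?_, hyp.mul hzp⟩
    rw [Zsqrtd.norm_mul, hy, hz, Nat.cast_mul]
  · -- injective
    rintro ⟨y, z⟩ hp ⟨y', z'⟩ hp' hyz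
    simp only at hyz
    rw [Finset.mem_product] at hp hp'
    obtain ⟨hy, hyp⟩ := mem_primaryNormEq.mp hp.1
    obtain ⟨hz, hzp⟩ := mem_primaryNormEq.mp hp.2
    obtain ⟨hy', hyp'⟩ := mem_primaryNormEq.mp hp'.1
    obtain ⟨hz', hzp'⟩ := mem_primaryNormEq.mp hp'.2
    have hc : IsCoprime y z' :=
      (hcop.of_isCoprime_of_dvd_left (hdvd hy)).of_isCoprime_of_dvd_right (hdvd hz')
    have h1 : y ∣ y' := hc.dvd_of_dvd_mul_right ⟨z, by rw [← hyz, mul_comm]⟩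
    obtain ⟨w, hw⟩ := h1
    have hm0 : (m : ℤ) ≠ 0 := by
      rw [← hy]; exact (GaussianInt.norm_pos.mpr hyp.ne_zero).ne'
    have hwn : w.norm = 1 := by
      have := congrArg Zsqrtd.norm hw
      rw [Zsqrtd.norm_mul, hy, hy'] at this
      exact (mul_right_inj' hm0).mp (by rw [← this, mul_one])
    have hwu : IsUnit w := (Zsqrtd.norm_eq_one_iff' (by norm_num) w).mp hwn
    have hyy' : y = y' := hyp.eq_of_associated hyp' ⟨hwu.unit, by rw [IsUnit.unit_spec, hw]⟩
    subst hyy'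
    have hzz' : z = z' := mul_left_cancel₀ hyp.ne_zero hyz
    subst hzz'
    rfl
  · -- surjective
    intro x hx
    obtain ⟨hxn, hxp⟩ := mem_primaryNormEq.mp hx
    -- `m`, `m'` are nonzero and `x` is odd
    have hm0 : m ≠ 0 := by
      rintro rfl
      rw [zero_mul, Nat.cast_zero, GaussianInt.norm_eq_zero] at hxn
      exact hxp.ne_zero hxn
    have hm0' : m' ≠ 0 := by
      rintro rfl
      rw [mul_zero, Nat.cast_zero, GaussianInt.norm_eq_zero] at hxn
      exact hxp.ne_zero hxn
    set g := EuclideanDomain.gcd x (m : ℤ[i]) with hg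
    set g' := EuclideanDomain.gcd x (m' : ℤ[i]) with hg'
    have hgx : g ∣ x := EuclideanDomain.gcd_dvd_left _ _
    have hgm : g ∣ (m : ℤ[i]) := EuclideanDomain.gcd_dvd_right _ _
    have hg'x : g' ∣ x := EuclideanDomain.gcd_dvd_left _ _
    have hg'm : g' ∣ (m' : ℤ[i]) := EuclideanDomain.gcd_dvd_right _ _
    have hcg : IsCoprime g g' :=
      (hcop.of_isCoprime_of_dvd_left hgm).of_isCoprime_of_dvd_right hg'm
    have h1 : g * g' ∣ x := hcg.mul_dvd hgx hg'x
    have hxmm : x ∣ (m : ℤ[i]) * m' := by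
      have := hdvd hxn
      rwa [Nat.cast_mul] at this
    have h2 : x ∣ g * g' := by
      rw [hg, hg', EuclideanDomain.gcd_eq_gcd_ab x (m : ℤ[i]), EuclideanDomain.gcd_eq_gcd_ab x (m' : ℤ[i])]
      set a := EuclideanDomain.gcdA x (m : ℤ[i])
      set b := EuclideanDomain.gcdB x (m : ℤ[i])
      set a' := EuclideanDomain.gcdA x (m' : ℤ[i])
      set b' := EuclideanDomain.gcdB x (m' : ℤ[i])
      have : (x * a + (m : ℤ[i]) * b) * (x * a' + (m' : ℤ[i]) * b') =
          x * (a * (x * a' + (m' : ℤ[i]) * b') + (m : ℤ[i]) * b * a') + (m : ℤ[i]) * m' * (b * b') := by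
        ring
      rw [this]
      exact dvd_add (dvd_mul_right _ _) (hxmm.mul_right _)
    have hassoc : Associated x (g * g') := associated_of_dvd_dvd h2 h1
    -- parities
    have hxodd : (x.re + x.im) % 2 = 1 := hxp.odd
    have hgodd : (g.re + g.im) % 2 = 1 := by
      have h3 := norm_dvd_norm hgx
      rw [← norm_emod_two]
      have hx2 : x.norm % 2 = 1 := hxp.norm_odd
      rcases Int.emod_two_eq_zero_or_one g.norm with h0 | h0
      · exfalso
        obtain ⟨c, hc⟩ := h3
        rw [hc, Int.mul_emod, h0] at hx2
        simp at hx2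
      · exact h0
    have hg'odd : (g'.re + g'.im) % 2 = 1 := by
      have h3 := norm_dvd_norm hg'x
      rw [← norm_emod_two]
      have hx2 : x.norm % 2 = 1 := hxp.norm_odd
      rcases Int.emod_two_eq_zero_or_one g'.norm with h0 | h0
      · exfalso
        obtain ⟨c, hc⟩ := h3
        rw [hc, Int.mul_emod, h0] at hx2
        simp at hx2
      · exact h0
    -- norms
    have hng : g.norm.natAbs ∣ m := by
      have h3 : g.norm.natAbs ∣ m * m := by
        have := norm_dvd_norm hgm
        rw [Zsqrtd.norm_natCast] at this
        exact Int.natAbs_dvd_natAbs.mpr this |>.trans (by simp [Int.natAbs_mul])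
      have h4 : g.norm.natAbs ∣ m * m' := by
        have := norm_dvd_norm hgx
        rw [hxn] at this
        have := Int.natAbs_dvd_natAbs.mpr this
        rwa [Int.natAbs_natCast] at this
      have h5 := Nat.dvd_gcd h3 h4
      rwa [Nat.gcd_mul_left, h.gcd_eq_one, mul_one] at h5
    have hng' : g'.norm.natAbs ∣ m' := by
      have h3 : g'.norm.natAbs ∣ m' * m' := by
        have := norm_dvd_norm hg'm
        rw [Zsqrtd.norm_natCast] at this
        exact Int.natAbs_dvd_natAbs.mpr this |>.trans (by simp [Int.natAbs_mul])
      have h4 : g'.norm.natAbs ∣ m * m' := by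
        have := norm_dvd_norm hg'x
        rw [hxn] at this
        have := Int.natAbs_dvd_natAbs.mpr this
        rwa [Int.natAbs_natCast] at this
      have h5 := Nat.dvd_gcd h4 h3
      rwa [Nat.gcd_mul_right, h.gcd_eq_one, one_mul] at h5
    have hN : g.norm.natAbs * g'.norm.natAbs = m * m' := by
      obtain ⟨u, hu⟩ := hassoc
      have := congrArg Zsqrtd.norm hu
      rw [Zsqrtd.norm_mul, Zsqrtd.norm_mul, (Zsqrtd.norm_eq_one_iff' (by norm_num) _).mpr u.isUnit,
        mul_one, hxn] at this
      have := congrArg Int.natAbs this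
      rwa [Int.natAbs_mul, Int.natAbs_natCast, eq_comm] at this
    obtain ⟨hgm_eq, hg'm_eq⟩ := eq_of_dvd_of_mul_eq hng hng' hN hm0 hm0'
    refine ⟨(primary g, primary g'), ?_, ?_⟩
    · rw [Finset.mem_product]
      refine ⟨mem_primaryNormEq.mpr ⟨?_, isPrimary_primary hgodd⟩,
        mem_primaryNormEq.mpr ⟨?_, isPrimary_primary hg'odd⟩⟩
      · rw [norm_primary hgodd, ← hgm_eq, Int.natAbs_of_nonneg (GaussianInt.norm_nonneg g)]
      · rw [norm_primary hg'odd, ← hg'm_eq, Int.natAbs_of_nonneg (GaussianInt.norm_nonneg g')]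
    · simp only
      rw [← primary_mul, ← primary_eq_primary_of_associated hassoc, primary_of_isPrimary hxp]

/-! ### Prime powers: inert primes `p ≡ 3 (mod 4)` -/

/-- `N(x^k) = N(x)^k`. [folklore] -/
theorem norm_pow' (x : ℤ[i]) (k : ℕ) : (x ^ k).norm = x.norm ^ k :=
  map_pow Zsqrtd.normMonoidHom x k

/-- `star p = p` for a natural number `p`. [folklore] -/
theorem star_natCast (p : ℕ) : star (p : ℤ[i]) = p := by
  ext <;> simp

/-- `p ∣ star x → p ∣ x` for a natural number `p`. [folklore] -/
theorem natCast_dvd_of_dvd_star {p : ℕ} {x : ℤ[i]} (h : (p : ℤ[i]) ∣ star x) : (p : ℤ[i]) ∣ x := by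
  obtain ⟨c, hc⟩ := h
  refine ⟨star c, ?_⟩
  have := congrArg star hc
  rwa [star_star, star_mul, star_natCast, mul_comm] at this

/-- The norm, cast into `ℤ[i]`, is `x · x̄`. [folklore] -/
theorem cast_norm_eq (x : ℤ[i]) : ((x.norm : ℤ) : ℤ[i]) = x * star x := Zsqrtd.norm_eq_mul_conj x

/-- `-p` is primary for `p ≡ 3 (mod 4)` (Ireland–Rosen, Ch. 18 §6: `χ((p)) = -p`). [folklore] -/
theorem isPrimary_neg_natCast {p : ℕ} (hp : p % 4 = 3) : IsPrimary (-(p : ℤ[i])) := by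
  unfold IsPrimary
  simp only [Zsqrtd.re_neg, Zsqrtd.im_neg, Zsqrtd.re_natCast, Zsqrtd.im_natCast, neg_zero]
  omega

/-- `primary p = -p` for `p ≡ 3 (mod 4)`. [folklore] -/
theorem primary_natCast_of_mod_four_eq_three {p : ℕ} (hp : p % 4 = 3) :
    primary (p : ℤ[i]) = -(p : ℤ[i]) := by
  rw [← primary_neg]; exact primary_of_isPrimary (isPrimary_neg_natCast hp)

/-- **Elements of norm `p^k` at an inert prime** `p ≡ 3 (mod 4)`: `k = 2j` and `x = u p^j`, `u` a
unit (`p` stays prime in `ℤ[i]`). [folklore] -/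
theorem associated_pow_of_norm_eq_pow_of_mod_four_eq_three {p : ℕ} [hpp : Fact p.Prime]
    (hp : p % 4 = 3) (k : ℕ) (x : ℤ[i]) (hx : x.norm = (p : ℤ) ^ k) :
    ∃ j : ℕ, k = 2 * j ∧ Associated x ((p : ℤ[i]) ^ j) := by
  induction k using Nat.strong_induction_on generalizing x with
  | _ k ih =>
    rcases k with _ | k
    · refine ⟨0, rfl, ?_⟩
      rw [pow_zero, associated_one_iff_isUnit, ← Zsqrtd.norm_eq_one_iff' (by norm_num) x, hx,
        pow_zero]
    · have hprime : Prime (p : ℤ[i]) :=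
        (GaussianInt.prime_iff_mod_four_eq_three_of_nat_prime p).mpr hp
      have hdvd : (p : ℤ[i]) ∣ x * star x := by
        rw [← cast_norm_eq, hx]
        push_cast
        exact dvd_pow_self _ (Nat.succ_ne_zero k)
      have hpx : (p : ℤ[i]) ∣ x := by
        rcases hprime.dvd_or_dvd hdvd with h | h
        · exact h
        · exact natCast_dvd_of_dvd_star h
      obtain ⟨x', rfl⟩ := hpx
      rcases k with _ | k
      · -- norm `p` is impossible
        exfalso
        rw [Zsqrtd.norm_mul, Zsqrtd.norm_natCast, zero_add, pow_one] at hx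
        have hx0 : x' ≠ 0 := by
          rintro rfl
          rw [Zsqrtd.norm_zero, mul_zero] at hx
          exact hpp.out.ne_zero (by exact_mod_cast hx.symm)
        have h1 : 1 ≤ x'.norm := GaussianInt.norm_pos.mpr hx0
        have hp2 : (2 : ℤ) ≤ p := by exact_mod_cast hpp.out.two_le
        nlinarith
      · have hx' : x'.norm = (p : ℤ) ^ k := by
          rw [Zsqrtd.norm_mul, Zsqrtd.norm_natCast, pow_succ, pow_succ] at hx
          have hp0 : (p : ℤ) ≠ 0 := by exact_mod_cast hpp.out.ne_zero
          apply mul_left_cancel₀ (mul_ne_zero hp0 hp0)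
          rw [hx]
          ring
        obtain ⟨j, hj, hassoc⟩ := ih k (by omega) x' hx'
        refine ⟨j + 1, by omega, ?_⟩
        rw [pow_succ, mul_comm ((p : ℤ[i]) ^ j)]
        exact (Associated.refl _).mul_mul hassoc

/-- **`S(p^{2j}) = (-p)^j`, `S(p^{2j+1}) = 0` at an inert prime `p ≡ 3 (mod 4)`** (the Euler
factor `(1 + p · p^{-2s})^{-1} = (1 - χ((p)) N(p)^{-s})^{-1}`, `χ((p)) = -p`; Ireland–Rosen,
Ch. 18 §6, proof of Theorem 7). [folklore] -/
theorem primaryNormEq_pow_of_mod_four_eq_three {p : ℕ} [Fact p.Prime] (hp : p % 4 = 3) (j : ℕ) :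
    primaryNormEq (p ^ (2 * j)) = {(-(p : ℤ[i])) ^ j} ∧ primaryNormEq (p ^ (2 * j + 1)) = ∅ := by
  constructor
  · refine Finset.eq_singleton_iff_unique_mem.mpr ⟨?_, fun x hx ↦ ?_⟩
    · refine mem_primaryNormEq.mpr ⟨?_, (isPrimary_neg_natCast hp).pow j⟩
      rw [norm_pow', Zsqrtd.norm_neg, Zsqrtd.norm_natCast]
      push_cast
      ring
    · obtain ⟨hxn, hxp⟩ := mem_primaryNormEq.mp hx
      obtain ⟨j', hj', hassoc⟩ := associated_pow_of_norm_eq_pow_of_mod_four_eq_three hp (2 * j) x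
        (by rw [hxn]; push_cast; ring)
      obtain rfl : j = j' := by omega
      rw [← primary_of_isPrimary hxp, primary_eq_primary_of_associated hassoc, primary_pow,
        primary_natCast_of_mod_four_eq_three hp]
  · ext x
    simp only [Finset.notMem_empty, iff_false]
    intro hx
    obtain ⟨hxn, -⟩ := mem_primaryNormEq.mp hx
    obtain ⟨j', hj', -⟩ := associated_pow_of_norm_eq_pow_of_mod_four_eq_three hp (2 * j + 1) x
      (by rw [hxn]; push_cast; ring)
    omega

/-- `S(p^{2j}) = (-p)^j` and `S(p^{2j+1}) = 0` for `p ≡ 3 (mod 4)`. [folklore] -/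
theorem primarySum_pow_of_mod_four_eq_three {p : ℕ} [Fact p.Prime] (hp : p % 4 = 3) (j : ℕ) :
    primarySum (p ^ (2 * j)) = (-(p : ℤ[i])) ^ j ∧ primarySum (p ^ (2 * j + 1)) = 0 := by
  obtain ⟨h1, h2⟩ := primaryNormEq_pow_of_mod_four_eq_three hp j
  simp [primarySum, h1, h2]

/-! ### Prime powers: split primes `p ≡ 1 (mod 4)` -/

/-- An element of prime norm is prime in `ℤ[i]`. [folklore] -/
theorem prime_of_norm_eq_prime {π : ℤ[i]} {p : ℕ} (hp : p.Prime) (h : π.norm = p) : Prime π := by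
  have hirr : Irreducible π := by
    refine irreducible_iff.mpr ⟨fun hu ↦ ?_, fun a b hab ↦ ?_⟩
    · have := (Zsqrtd.norm_eq_one_iff' (by norm_num) π).mpr hu
      rw [h] at this
      exact hp.ne_one (by exact_mod_cast this)
    · have hn := congrArg Zsqrtd.norm hab
      rw [Zsqrtd.norm_mul, h] at hn
      have hn' := congrArg Int.natAbs hn
      rw [Int.natAbs_natCast, Int.natAbs_mul] at hn'
      rcases Nat.prime_mul_iff.mp (hn' ▸ hp) with ⟨-, hb⟩ | ⟨-, ha⟩
      · exact Or.inr (Zsqrtd.norm_eq_one_iff.mp hb)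
      · exact Or.inl (Zsqrtd.norm_eq_one_iff.mp ha)
  exact hirr.prime

/-- A prime is not a square. [folklore] -/
theorem not_prime_mul_self (n : ℕ) : ¬ (n * n).Prime := fun h ↦ by
  rcases Nat.prime_mul_iff.mp h with ⟨hn, h1⟩ | ⟨hn, h1⟩ <;> exact hn.ne_one h1

/-- **`π` and `π̄` are not associated** when `N(π) = p ≡ 1 (mod 4)` is prime (`p` splits into
two distinct primes). [folklore] -/
theorem not_dvd_star_of_norm_eq_prime {π : ℤ[i]} {p : ℕ} (hp : p.Prime) (hp1 : p % 4 = 1)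
    (h : π.norm = p) : ¬ π ∣ star π := by
  rintro ⟨c, hc⟩
  have hp0 : (p : ℤ) ≠ 0 := by exact_mod_cast hp.ne_zero
  have hn := congrArg Zsqrtd.norm hc
  rw [Zsqrtd.norm_conj, Zsqrtd.norm_mul, h] at hn
  have hc1 : c.norm = 1 := (mul_right_inj' hp0).mp (by rw [← hn, mul_one])
  have hcu : IsUnit c := (Zsqrtd.norm_eq_one_iff' (by norm_num) c).mp hc1
  obtain ⟨a, b⟩ := π
  have hpab : (p : ℤ) = a * a + b * b := by rw [← h, Zsqrtd.norm_def]; ring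
  have hre := congrArg Zsqrtd.re hc
  have him := congrArg Zsqrtd.im hc
  rcases eq_of_isUnit hcu with rfl | rfl | rfl | rfl <;>
    simp only [Zsqrtd.re_star, Zsqrtd.im_star, mul_one, mul_neg, Zsqrtd.re_neg, Zsqrtd.im_neg,
      Zsqrtd.re_mul, Zsqrtd.im_mul] at hre him
  · have hb : b = 0 := by omega
    subst hb
    apply not_prime_mul_self a.natAbs
    have : a.natAbs * a.natAbs = p := by
      zify
      rw [abs_mul_abs_self]
      linarith
    rw [this]
    exact hp
  · have ha : a = 0 := by omega
    subst ha
    apply not_prime_mul_self b.natAbs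
    have : b.natAbs * b.natAbs = p := by
      zify
      rw [abs_mul_abs_self]
      linarith
    rw [this]
    exact hp
  · have ha : a = -b := by omega
    have h2 : (2 : ℕ) ∣ p := by
      refine Int.natCast_dvd_natCast.mp ⟨b * b, ?_⟩
      rw [hpab, ha]; ring
    have := (hp.eq_one_or_self_of_dvd 2 h2).resolve_left (by decide)
    omega
  · have ha : a = b := by omega
    have h2 : (2 : ℕ) ∣ p := by
      refine Int.natCast_dvd_natCast.mp ⟨b * b, ?_⟩
      rw [hpab, ha]; ring
    have := (hp.eq_one_or_self_of_dvd 2 h2).resolve_left (by decide)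
    omega

/-- `p = π π̄` in `ℤ[i]` when `N(π) = p`. [folklore] -/
theorem natCast_eq_mul_star {π : ℤ[i]} {p : ℕ} (h : π.norm = p) : (p : ℤ[i]) = π * star π := by
  rw [← cast_norm_eq, h, Int.cast_natCast]

/-- **Elements of norm `p^k` at a split prime**: `x = u π^j π̄^{k-j}` with `u` a unit
(unique factorisation in `ℤ[i]`). [folklore] -/
theorem associated_pow_mul_pow_of_norm_eq_pow {π : ℤ[i]} {p : ℕ} (hp : p.Prime) (h : π.norm = p)
    (k : ℕ) (x : ℤ[i]) (hx : x.norm = (p : ℤ) ^ k) :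
    ∃ j ≤ k, Associated x (π ^ j * star π ^ (k - j)) := by
  have hprime := prime_of_norm_eq_prime hp h
  have hp0 : (p : ℤ) ≠ 0 := by exact_mod_cast hp.ne_zero
  induction k generalizing x with
  | zero =>
    refine ⟨0, le_rfl, ?_⟩
    rw [pow_zero, Nat.sub_zero, pow_zero, mul_one, associated_one_iff_isUnit,
      ← Zsqrtd.norm_eq_one_iff' (by norm_num) x, hx, pow_zero]
  | succ k ih =>
    have hdvd : π ∣ x * star x := by
      rw [← cast_norm_eq, hx]
      push_cast
      rw [natCast_eq_mul_star h]
      exact dvd_pow (dvd_mul_right π (star π)) (Nat.succ_ne_zero k)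
    have hstar : star π ∣ x → ∃ x', x = star π * x' := fun ⟨c, hc⟩ ↦ ⟨c, hc⟩
    rcases hprime.dvd_or_dvd hdvd with hπx | hπx
    · obtain ⟨x', rfl⟩ := hπx
      have hx' : x'.norm = (p : ℤ) ^ k := by
        rw [Zsqrtd.norm_mul, h, pow_succ, mul_comm ((p : ℤ) ^ k)] at hx
        exact mul_left_cancel₀ hp0 hx
      obtain ⟨j, hj, hassoc⟩ := ih x' hx'
      refine ⟨j + 1, by omega, ?_⟩
      rw [show k + 1 - (j + 1) = k - j by omega, pow_succ,
        show π ^ j * π * star π ^ (k - j) = π * (π ^ j * star π ^ (k - j)) by ring]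
      exact (Associated.refl π).mul_mul hassoc
    · have hσx : star π ∣ x := by
        obtain ⟨c, hc⟩ := hπx
        refine ⟨star c, ?_⟩
        have := congrArg star hc
        rwa [star_star, star_mul, mul_comm] at this
      obtain ⟨x', rfl⟩ := hσx
      have hx' : x'.norm = (p : ℤ) ^ k := by
        rw [Zsqrtd.norm_mul, Zsqrtd.norm_conj, h, pow_succ, mul_comm ((p : ℤ) ^ k)] at hx
        exact mul_left_cancel₀ hp0 hx
      obtain ⟨j, hj, hassoc⟩ := ih x' hx'
      refine ⟨j, by omega, ?_⟩
      rw [show k + 1 - j = (k - j) + 1 by omega, pow_succ,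
        show π ^ j * (star π ^ (k - j) * star π) = star π * (π ^ j * star π ^ (k - j)) by ring]
      exact (Associated.refl (star π)).mul_mul hassoc

/-- `j ↦ π^j π̄^{k-j}` is injective on `0 ≤ j ≤ k` (as `π ∤ π̄`). [folklore] -/
theorem injOn_pow_mul_pow {π : ℤ[i]} {p : ℕ} (hp : p.Prime) (hp1 : p % 4 = 1) (h : π.norm = p)
    (k : ℕ) : Set.InjOn (fun j : ℕ ↦ π ^ j * star π ^ (k - j)) (Finset.range (k + 1) : Set ℕ) := by
  have hprime := prime_of_norm_eq_prime hp h
  have hns := not_dvd_star_of_norm_eq_prime hp hp1 h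
  have hσ0 : star π ≠ 0 := fun h0 ↦ hns (h0 ▸ dvd_zero π)
  -- the case `j₁ < j₂` is contradictory
  have key : ∀ j₁ j₂ : ℕ, j₂ ≤ k → j₁ < j₂ →
      π ^ j₁ * star π ^ (k - j₁) ≠ π ^ j₂ * star π ^ (k - j₂) := by
    intro j₁ j₂ hj₂ hlt heq
    rw [show j₂ = j₁ + (j₂ - j₁) by omega, pow_add, mul_assoc] at heq
    have heq' := mul_left_cancel₀ (pow_ne_zero _ hprime.ne_zero) heq
    have hdvd : π ∣ star π ^ (k - j₁) := by
      rw [heq']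
      exact dvd_mul_of_dvd_left (dvd_pow_self π (by omega)) _
    exact hns (hprime.dvd_of_dvd_pow hdvd)
  intro j₁ hj₁ j₂ hj₂ heq
  simp only [Finset.coe_range, Set.mem_Iio] at hj₁ hj₂
  rcases lt_trichotomy j₁ j₂ with hlt | rfl | hgt
  · exact absurd heq (key j₁ j₂ (by omega) hlt)
  · rfl
  · exact absurd heq.symm (key j₂ j₁ (by omega) hgt)

/-- **Primary elements of norm `p^k` at a split prime `p = π π̄`**, `π` primary: exactly the
`π^j π̄^{k-j}`, `0 ≤ j ≤ k` (Ireland–Rosen, Ch. 18 §6, proof of Theorem 7: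
`1 - a_p p^{-s} + p^{1-2s} = (1 - χ(P) NP^{-s})(1 - χ(P̄) N P̄^{-s})`). [folklore] -/
theorem primaryNormEq_pow_of_mod_four_eq_one {π : ℤ[i]} {p : ℕ} (hp : p.Prime)
    (hπ : IsPrimary π) (h : π.norm = p) (k : ℕ) :
    primaryNormEq (p ^ k) = (Finset.range (k + 1)).image fun j ↦ π ^ j * star π ^ (k - j) := by
  ext x
  rw [mem_primaryNormEq, Finset.mem_image]
  constructor
  · rintro ⟨hxn, hxp⟩
    obtain ⟨j, hj, hassoc⟩ := associated_pow_mul_pow_of_norm_eq_pow hp h k x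
      (by rw [hxn]; push_cast; ring)
    refine ⟨j, Finset.mem_range.mpr (by omega), ?_⟩
    rw [← primary_of_isPrimary hxp, primary_eq_of_associated hassoc ((hπ.pow j).mul (hπ.star.pow _))]
  · rintro ⟨j, hj, rfl⟩
    refine ⟨?_, (hπ.pow j).mul (hπ.star.pow _)⟩
    rw [Finset.mem_range] at hj
    rw [Zsqrtd.norm_mul, norm_pow', norm_pow', Zsqrtd.norm_conj, h, ← pow_add,
      show j + (k - j) = k by omega]
    push_cast
    ring

/-- **`S(p^k) = ∑_{j=0}^{k} π^j π̄^{k-j}` at a split prime** `p ≡ 1 (mod 4)`, `p = N(π)`, `π`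
primary. [folklore] -/
theorem primarySum_pow_of_mod_four_eq_one {π : ℤ[i]} {p : ℕ} (hp : p.Prime) (hp1 : p % 4 = 1)
    (hπ : IsPrimary π) (h : π.norm = p) (k : ℕ) :
    primarySum (p ^ k) = ∑ j ∈ Finset.range (k + 1), π ^ j * star π ^ (k - j) := by
  rw [primarySum, primaryNormEq_pow_of_mod_four_eq_one hp hπ h k,
    Finset.sum_image (injOn_pow_mul_pow hp hp1 h k)]

/-- The two-step recursion of `T_k = ∑_{j ≤ k} π^j σ^{k-j}`:
`T_{k+2} = (π + σ) T_{k+1} - π σ T_k` (the coefficients of `1/((1 - π X)(1 - σ X))`). [folklore] -/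
theorem sum_pow_mul_pow_rec {R : Type*} [CommRing R] (π σ : R) (k : ℕ) :
    ∑ j ∈ Finset.range (k + 3), π ^ j * σ ^ (k + 2 - j) =
      (π + σ) * ∑ j ∈ Finset.range (k + 2), π ^ j * σ ^ (k + 1 - j) -
        π * σ * ∑ j ∈ Finset.range (k + 1), π ^ j * σ ^ (k - j) := by
  have e1 : π * ∑ j ∈ Finset.range (k + 2), π ^ j * σ ^ (k + 1 - j) =
      ∑ j ∈ Finset.range (k + 2), π ^ (j + 1) * σ ^ (k + 1 - j) := by
    rw [Finset.mul_sum]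
    exact Finset.sum_congr rfl fun j _ ↦ by ring
  have e2 : π * σ * ∑ j ∈ Finset.range (k + 1), π ^ j * σ ^ (k - j) =
      ∑ j ∈ Finset.range (k + 1), π ^ (j + 1) * σ ^ (k + 1 - j) := by
    rw [Finset.mul_sum]
    refine Finset.sum_congr rfl fun j hj ↦ ?_
    rw [Finset.mem_range] at hj
    rw [show k + 1 - j = (k - j) + 1 by omega, pow_succ, pow_succ]
    ring
  have e3 : σ * ∑ j ∈ Finset.range (k + 2), π ^ j * σ ^ (k + 1 - j) =
      ∑ j ∈ Finset.range (k + 2), π ^ j * σ ^ (k + 2 - j) := by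
    rw [Finset.mul_sum]
    refine Finset.sum_congr rfl fun j hj ↦ ?_
    rw [Finset.mem_range] at hj
    rw [show k + 2 - j = (k + 1 - j) + 1 by omega, pow_succ]
    ring
  have e4 : ∑ j ∈ Finset.range (k + 2), π ^ (j + 1) * σ ^ (k + 1 - j) =
      ∑ j ∈ Finset.range (k + 1), π ^ (j + 1) * σ ^ (k + 1 - j) + π ^ (k + 2) := by
    rw [Finset.sum_range_succ, Nat.sub_self, pow_zero, mul_one]
  have e5 : ∑ j ∈ Finset.range (k + 3), π ^ j * σ ^ (k + 2 - j) =
      ∑ j ∈ Finset.range (k + 2), π ^ j * σ ^ (k + 2 - j) + π ^ (k + 2) := by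
    rw [Finset.sum_range_succ, Nat.sub_self, pow_zero, mul_one]
  rw [add_mul, e1, e2, e3, e4, e5]
  ring

/-- **Existence of a primary `π` with `N(π) = p`** for `p ≡ 1 (mod 4)` (Fermat–Euler two squares,
Mathlib's `Nat.Prime.sq_add_sq`, then pass to the primary associate). [folklore] -/
theorem exists_isPrimary_norm_eq {p : ℕ} [hpp : Fact p.Prime] (hp1 : p % 4 = 1) :
    ∃ π : ℤ[i], IsPrimary π ∧ π.norm = p := by
  obtain ⟨a, b, hab⟩ := Nat.Prime.sq_add_sq (p := p) (by omega)
  let x : ℤ[i] := ⟨a, b⟩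
  have hx : x.norm = p := by
    rw [Zsqrtd.norm_def, ← hab]; push_cast; ring
  have hodd : (x.re + x.im) % 2 = 1 := by
    rw [← norm_emod_two, hx]
    omega
  exact ⟨primary x, isPrimary_primary hodd, by rw [norm_primary hodd, hx]⟩


end GaussianPrimary

end Literature.NumberTheory.QuadraticFields
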